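import Summits.AtomisticToContinuum.HydrodynamicLimit.Theses.TwoClocks
import Summits.AtomisticToContinuum.HydrodynamicLimit.Theorems.KineticFluxLdDecay.Negative.GibbsTilts
import Summits.AtomisticToContinuum.HydrodynamicLimit.Theorems.KineticCurrentsWindowLDUniform.Negative.ForallN

/-!
# `TransferEntropyClock` (stmt-AtomisticToContinuum-16625): the `∀ β` kinetic child is FALSE — invariant Gibbs tilts

Negative knowledge for the crux `TwoClocks.TransferEntropyClock` (route TwoClocks, rank 11: the macroscopic
clock `KineticWindowLDUniform → ClampedTransferWindowLD → TransferActivityTails → EnergyCurrentTails →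
DiluteSelfConsistency → HydrodynamicLimit`), from the standing disprover's
`Cruxes/TransferEntropyClock/Disproof.lean` §5 (refuter-cdisprove-stmt-AtomisticToContinuum-16625-0).

The crux itself is sandwiched `HydrodynamicLimit → TransferEntropyClock`, so it can only die through its parts,
and its foreseen SPLIT (route text, TWO-LAYER PLAN) re-types the kinetic docking node. Three seats around this
crux proposed the SAME re-typing — the docking node for BOUNDED fast one-body functionals in the `∀ β` shape
(`∀ β ∀ ε ∃ τ ∃ N₀`, "every tilt is admissible for a bounded functional"):
`QuenchedCellClock.KineticWindowLDUniformBounded` (repair R1 of crux 15145, `Cruxes/ClampedEntropyClock/Lines/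
IdeatorTwoSketch_restated.lean`, antecedent of `ClampedEntropyClockRestated`), the predecessor disprover's R1
(`Theorems/ClampedEntropyClock/Negative/EnergyRowShapes.lean`, `allBeta_gronwallBound_small`) and ideator 2's
`KineticWindowLDBoundedAllBeta` (`Cruxes/TransferEntropyClock/IdeatorTwoSketch.lean` §3, first antecedent of
`TaggedNetClock`). `KineticWindowLDBoundedAllBeta` below is that text VERBATIM, and it is FALSE:

* `not_kineticWindowLDBoundedAllBeta` — witness `η₀` arbitrary, `a = θ₀ = 1`, `u₀ = 0`, `σ = min(1/4, η₀, 1)`,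
  the regular Alexander flows `KineticFluxLdDecayTilt.regFlowCrux`, the bounded functional
  `F(x, v) = 8 (cos v₁ − cos v₀)` (orthogonal to `1, v_j, |v|²` under `M_{1,0,1}` by the swap `v₀ ↔ v₁` and
  parity), `β = 2`, `ε = 1`, `N = N₀`. Mechanism (Donsker–Varadhan with an INVARIANT tilt,
  `KineticFluxLdDecayTilt.tilt_lower_bound`): the reference homogeneous Gibbs law is the DRIFTED homogeneous
  Gibbs law (drift `e₀`) times `e^{∑ᵢ llr1(vᵢ)}` with equal partition functions; the drifted law is again
  flow-invariant, so the window average costs nothing and Jensen gives, for EVERY window and EVERY `N`,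
  `(N+1)⁻¹ log ∫ exp(β ∑ᵢ w⁻¹∫₀ʷ F) dG_N ≥ β · E_{N(e₀,1)} F − KL(N(e₀,1) ‖ N(0,1)) = 8β e^{-1/2}(1 − cos 1) − 1/2`
  `≥ (43/24)β − 1/2`, which exceeds `ε = 1` at `β = 2`.

Moral for the planner / provers of crux 11 and its children: orthogonality to the collision invariants is a
FIRST-ORDER condition; the exponential moment at tilt `β` sees the SECOND-ORDER response of `F` to the conserved
parameters `(u, θ)` (here `E_{N(u,1)} F = 8e^{-1/2}(1 − cos u₀) ≈ 4e^{-1/2}u₀²` against the entropy cost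
`u₀²/2`), so a window-LD node can only hold for `|β| ≤ β₀` with `β₀ ≲ (curvature of the entropy cost)/(second-
order equilibrium response of F)`. The `∀ β` shape is false for every bounded admissible `F` with a non-vanishing
second-order response — i.e. generically — at every `N` and every window; any clock typed on it
(`TaggedNetClock`, `ClampedEntropyClockRestated`) is VACUOUSLY true and feeds nothing. The consistent repair of
the energy-row bookkeeping (`EnergyRowShapes`) is a tilt threshold UNIFORM ALONG THE TRUNCATION FAMILY `F_M` of a
fixed quadratic-growth functional (its second-order response is `M`-uniform), not `∀ β`.
-/

noncomputable section

namespace Summit.AtomisticToContinuum.HydrodynamicLimit.Theorems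

open MeasureTheory ProbabilityTheory Real
open scoped ENNReal InnerProductSpace
open Literature.MathematicalPhysics.KineticTheory Literature.Analysis.FluidPDE
open KineticFluxLdDecayTilt

namespace TransferEntropyClockNegative

/-- **A FALSE proposition — NOT a citable fact.** The `∀ β` kinetic docking node for BOUNDED fast functionals
(verbatim `QuenchedCellClock.KineticWindowLDUniformBounded` = ideator 2's `KineticWindowLDBoundedAllBeta`):
frame of `TwoClocks.KineticWindowLDUniform` (local Gibbs data, `η₀`-uniform packing guard, `F` continuous,
bounded, orthogonal at every `x` under `M_(1,u₀(x),θ₀(x))` to `1, v_j, |v|²`), conclusion `∀ β ∀ ε ∃ τ ∃ N₀`.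
Kept only as the statement that `not_kineticWindowLDBoundedAllBeta` negates (no provenance tag on purpose). -/
def KineticWindowLDBoundedAllBeta : Prop :=
  ∃ η₀ : ℝ, 0 < η₀ ∧ ∀ (a θ₀ : T3 → ℝ) (u₀ : T3 → V3), Continuous a → Continuous θ₀ → Continuous u₀ → (∀ x, 0 < a x) →
    (∀ x, 0 < θ₀ x) → ∀ σ : ℝ, 0 < σ → σ ^ 3 * (⨆ x, a x) ≤ η₀ * ∫ x, a x →
    ∀ Φ : (N : ℕ) → HardSphereFlow (Torus.geometry (Fin 3)) (hsDiameter σ N) (N + 1),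
    ∀ F : T3 × V3 → ℝ, Continuous F → (∃ C : ℝ, ∀ y, |F y| ≤ C) →
    (∀ x, ∫ v, F (x, v) * localMaxwellian 1 (θ₀ x) (u₀ x) v = 0) →
    (∀ x (j : Fin 3), ∫ v, F (x, v) * v j * localMaxwellian 1 (θ₀ x) (u₀ x) v = 0) →
    (∀ x, ∫ v, F (x, v) * ‖v‖ ^ 2 * localMaxwellian 1 (θ₀ x) (u₀ x) v = 0) →
    ∀ β : ℝ, ∀ ε : ℝ, 0 < ε → ∃ τ : ℝ, 0 < τ ∧ ∃ N₀ : ℕ, ∀ N : ℕ, N₀ ≤ N →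
      ∫⁻ z, ENNReal.ofReal (Real.exp (β * ∑ i : Fin (N + 1), (τ * ((N : ℝ) + 1) ^ (-(1 / 3 : ℝ)))⁻¹ *
          ∫ r in (0 : ℝ)..(τ * ((N : ℝ) + 1) ^ (-(1 / 3 : ℝ))), F (((Φ N).flow r z) i)))
        ∂(localGibbsLaw σ a u₀ θ₀ N (Φ N)) ≤ ENNReal.ofReal (Real.exp (ε * ((N : ℝ) + 1)))

/-! ### The witness functional `F(v) = 8 (cos v₁ − cos v₀)` -/

/-- The witness: `g(v) = 8 (cos v₁ − cos v₀)` (bounded, continuous). [folklore] -/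
def gTilt (v : V3) : ℝ := 8 * (Real.cos (v 1) - Real.cos (v 0))

/-- `g` is continuous. [folklore] -/
theorem continuous_gTilt : Continuous gTilt :=
  continuous_const.mul
    ((Real.continuous_cos.comp (continuous_coord 1)).sub (Real.continuous_cos.comp (continuous_coord 0)))

/-- `|g| ≤ 16`. [folklore] -/
theorem abs_gTilt_le (v : V3) : |gTilt v| ≤ 16 := by
  unfold gTilt
  rw [abs_mul]
  have h1 := Real.abs_cos_le_one (v 0)
  have h2 := Real.abs_cos_le_one (v 1)
  have : |Real.cos (v 1) - Real.cos (v 0)| ≤ 2 := by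
    calc _ ≤ |Real.cos (v 1)| + |Real.cos (v 0)| := abs_sub _ _
      _ ≤ 2 := by linarith
  norm_num
  nlinarith

/-- `g ⊥ span{1, ⟪b,·⟫, ‖·‖²}` under the standard Gaussian (swap symmetry `v₀ ↔ v₁` for the even part,
parity for the odd part). [folklore] -/
theorem integral_gTilt_mul_eq_zero (c₀ c₂ : ℝ) (b : V3) :
    ∫ v, gTilt v * (c₀ + inner ℝ b v + c₂ * ‖v‖ ^ 2) ∂stdGaussian V3 = 0 := by
  have hgc := continuous_gTilt
  have hgK := abs_gTilt_le
  have hsplit : ∀ v : V3, gTilt v * (c₀ + inner ℝ b v + c₂ * ‖v‖ ^ 2) =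
      gTilt v * (c₀ + c₂ * ‖v‖ ^ 2) + gTilt v * ⟪b, v⟫_ℝ := fun v => by ring
  simp_rw [hsplit]
  have hi1 : Integrable (fun v : V3 => gTilt v * (c₀ + c₂ * ‖v‖ ^ 2)) (stdGaussian V3) :=
    ((integrable_const c₀).add (integrable_norm_sq_stdGaussian.const_mul c₂)).bdd_mul
      hgc.aestronglyMeasurable (ae_of_all _ fun v => by rw [Real.norm_eq_abs]; exact hgK v)
  have hi2 : Integrable (fun v => gTilt v * ⟪b, v⟫_ℝ) (stdGaussian V3) :=
    (integrable_inner_stdGaussian b).bdd_mul hgc.aestronglyMeasurable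
      (ae_of_all _ fun v => by rw [Real.norm_eq_abs]; exact hgK v)
  rw [integral_add hi1 hi2,
    integral_eq_zero_of_odd_stdGaussian (f := fun v : V3 => gTilt v * ⟪b, v⟫_ℝ) fun v => by
      simp only [gTilt, PiLp.neg_apply, Real.cos_neg, inner_neg_right]; ring]
  have hanti : ∀ v : V3, gTilt (swap01 v) * (c₀ + c₂ * ‖swap01 v‖ ^ 2) =
      -(gTilt v * (c₀ + c₂ * ‖v‖ ^ 2)) := fun v => by
    rw [LinearIsometryEquiv.norm_map, gTilt, gTilt, swap01_apply_zero, swap01_apply_one]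
    ring
  have hinv := integral_comp_linearIsometryEquiv_stdGaussian swap01
    (fun v : V3 => gTilt v * (c₀ + c₂ * ‖v‖ ^ 2))
  simp only [hanti, integral_neg] at hinv
  linarith

/-- `g ⊥ 1` under `M_{1,0,1}`. [folklore] -/
theorem gTilt_orth_one : ∫ v, gTilt v * localMaxwellian 1 1 (0 : V3) v = 0 := by
  have h := integral_gTilt_mul_eq_zero 1 0 0
  simp only [inner_zero_left, add_zero, zero_mul, mul_one] at h
  rw [KineticCurrentsWindowLDUniformOneSphere.integral_mul_localMaxwellian_eq]
  exact h

/-- `g ⊥ v_j` under `M_{1,0,1}`. [folklore] -/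
theorem gTilt_orth_mom (j : Fin 3) : ∫ v, gTilt v * v j * localMaxwellian 1 1 (0 : V3) v = 0 := by
  have h := integral_gTilt_mul_eq_zero 0 0 (EuclideanSpace.single j 1)
  simp only [zero_add, zero_mul, add_zero, EuclideanSpace.inner_single_left, map_one, one_mul] at h
  rw [KineticCurrentsWindowLDUniformOneSphere.integral_mul_localMaxwellian_eq]
  exact h

/-- `g ⊥ ‖v‖²` under `M_{1,0,1}`. [folklore] -/
theorem gTilt_orth_energy : ∫ v, gTilt v * ‖v‖ ^ 2 * localMaxwellian 1 1 (0 : V3) v = 0 := by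
  have h := integral_gTilt_mul_eq_zero 0 1 0
  simp only [inner_zero_left, add_zero, zero_add, one_mul] at h
  rw [KineticCurrentsWindowLDUniformOneSphere.integral_mul_localMaxwellian_eq]
  exact h

/-! ### The refutation -/

/-- **THE `∀ β` KINETIC CHILD IS FALSE** (R1 = `KineticWindowLDUniformBounded` = `KineticWindowLDBoundedAllBeta`).
Witness: `η₀` arbitrary, `a = θ₀ = 1`, `u₀ = 0`, `σ = min(1/4, η₀, 1)`, the regular Alexander flows,
`F(x,v) = 8(cos v₁ − cos v₀)`, `β = 2`, `ε = 1`, `N = N₀`: by the invariant DRIFT tilt `u₁ = e₀`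
(`KineticFluxLdDecayTilt.tilt_lower_bound`) the per-particle pressure of the window functional is
`≥ 2 · 8e^{-1/2}(1 − cos 1) − 1/2 ≥ 43/12 − 1/2 > 1` at EVERY window and EVERY `N`. [folklore] -/
theorem not_kineticWindowLDBoundedAllBeta : ¬ KineticWindowLDBoundedAllBeta := by
  rintro ⟨η₀, hη₀, h⟩
  -- parameters
  set σ : ℝ := min (1 / 4) (min η₀ 1) with hσdef
  have hσpos : 0 < σ := lt_min (by norm_num) (lt_min hη₀ one_pos)
  have hσ4 : σ ≤ 1 / 4 := min_le_left _ _
  have hση : σ ≤ η₀ := (min_le_right _ _).trans (min_le_left _ _)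
  have hσ1 : σ ≤ 1 := (min_le_right _ _).trans (min_le_right _ _)
  have hσhalf' : σ < 2⁻¹ := hσ4.trans_lt (by norm_num)
  have hguard : σ ^ 3 * (⨆ _x : T3, (1 : ℝ)) ≤ η₀ * ∫ _x : T3, (1 : ℝ) := by
    have hsup : (⨆ _x : T3, (1 : ℝ)) = 1 := ciSup_const
    have hint : ∫ _x : T3, (1 : ℝ) = 1 := by simp
    rw [hsup, hint, mul_one, mul_one]
    calc σ ^ 3 ≤ σ := by
          have : σ ^ 3 ≤ σ ^ 1 := pow_le_pow_of_le_one hσpos.le hσ1 (by norm_num)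
          simpa using this
      _ ≤ η₀ := hση
  -- the flow family (regular Alexander flows) and the functional
  have hmain := h (fun _ => 1) (fun _ => 1) (fun _ => 0) continuous_const continuous_const
    continuous_const (fun _ => one_pos) (fun _ => one_pos) σ hσpos hguard (regFlowCrux hσpos hσhalf')
    (fun y => gTilt y.2)
    (continuous_gTilt.comp continuous_snd) ⟨16, fun y => abs_gTilt_le y.2⟩
    (fun _ => gTilt_orth_one) (fun _ j => gTilt_orth_mom j) (fun _ => gTilt_orth_energy) 2 1 one_pos
  obtain ⟨τ, hτ, N₀, hN⟩ := hmain
  have key := hN N₀ le_rfl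
  clear hN h
  -- the window
  set w : ℝ := τ * ((N₀ : ℝ) + 1) ^ (-(1 / 3 : ℝ)) with hw
  have hwpos : 0 < w := mul_pos hτ (Real.rpow_pos_of_pos (by positivity) _)
  -- interchange `∑ᵢ` and `∫₀ʷ`, absorb `β = 2` into the observable
  set g : V3 → ℝ := fun v => 2 * gTilt v with hg
  have hgc : Continuous g := continuous_const.mul continuous_gTilt
  have hgK : ∀ v, |g v| ≤ 32 := fun v => by
    rw [hg]; dsimp only; rw [abs_mul]
    have := abs_gTilt_le v
    norm_num
    linarith
  set Φ := regFlowCrux hσpos hσhalf' N₀ with hΦ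
  have hII : ∀ (z : Config (N₀ + 1) (Fin 3) T3) (i : Fin (N₀ + 1)),
      IntervalIntegrable (fun r => gTilt (Φ.flow r z i).2) volume 0 w := by
    intro z i
    have h2 : Measurable fun r : ℝ => (Φ.flow r z i).2 :=
      ((measurable_pi_apply i).comp (measurable_regFlowCrux_uncurry hσpos hσhalf' N₀).of_uncurry_right).snd
    have hm : Measurable fun r : ℝ => gTilt (Φ.flow r z i).2 := continuous_gTilt.measurable.comp h2
    refine (intervalIntegrable_const (c := (16 : ℝ))).mono_fun' hm.aestronglyMeasurable ?_
    exact ae_of_all _ fun r => by simpa [Real.norm_eq_abs] using abs_gTilt_le (Φ.flow r z i).2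
  have hpt : ∀ z : Config (N₀ + 1) (Fin 3) T3,
      2 * ∑ i : Fin (N₀ + 1), (w⁻¹ * ∫ r in (0 : ℝ)..w, gTilt ((Φ.flow r z) i).2) =
        w⁻¹ * ∫ s in (0 : ℝ)..w, ∑ i, 2 * gTilt ((Φ.flow s z i).2) := by
    intro z
    rw [intervalIntegral.integral_finsetSum (fun i _ => ((hII z i).const_mul 2))]
    simp only [intervalIntegral.integral_const_mul]
    rw [Finset.mul_sum, Finset.mul_sum]
    refine Finset.sum_congr rfl fun i _ => ?_
    ring
  have hEq : ∫⁻ z, ENNReal.ofReal (Real.exp (w⁻¹ * ∫ s in (0 : ℝ)..w,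
        ∑ i, g ((Φ.flow s z i).2)))
        ∂(localGibbsLaw σ (fun _ => 1) (fun _ => 0) (fun _ => 1) N₀ Φ) =
      ∫⁻ z, ENNReal.ofReal (Real.exp (2 * ∑ i : Fin (N₀ + 1), (w⁻¹ *
        ∫ r in (0 : ℝ)..w, gTilt ((Φ.flow r z) i).2)))
        ∂(localGibbsLaw σ (fun _ => 1) (fun _ => 0) (fun _ => 1) N₀ Φ) :=
    lintegral_congr fun z => by rw [hpt z]
  have key' : ∫⁻ z, ENNReal.ofReal (Real.exp (w⁻¹ * ∫ s in (0 : ℝ)..w,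
        ∑ i, g ((Φ.flow s z i).2)))
        ∂(localGibbsLaw σ (fun _ => 1) (fun _ => 0) (fun _ => 1) N₀ Φ) ≤
      ENNReal.ofReal (Real.exp (1 * ((N₀ : ℝ) + 1))) := hEq.le.trans key
  -- the invariant drift tilt `u₁ = e₀`
  have hΓ := KineticFluxLdDecayWith.gamma_le one_pos (EuclideanSpace.single (0 : Fin 3) (1 : ℝ))
    hgc hgK hwpos key'
  obtain ⟨hc_lo, hc_hi⟩ := exp_neg_half_bounds
  set c : ℝ := Real.exp (-1 / 2) with hc
  have hshift : ∀ v : V3, g (EuclideanSpace.single (0 : Fin 3) (1 : ℝ) + Real.sqrt 1 • v) =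
      16 * (Real.cos (0 + 1 * v 1) - Real.cos (1 + 1 * v 0)) := fun v => by
    simp [hg, gTilt]
    ring
  rw [integral_add (integrable_comp_shift_of_abs_le hgc hgK _ _) (integrable_llr1_comp_shift one_pos _),
    integral_llr1_drift] at hΓ
  simp_rw [hshift] at hΓ
  have hci1 : Integrable (fun v : V3 => Real.cos (0 + 1 * v 1)) (stdGaussian V3) :=
    integrable_of_abs_le_stdGaussian (f := fun v : V3 => Real.cos (0 + 1 * v 1))
      (Real.continuous_cos.comp (continuous_const.add (continuous_const.mul (continuous_coord 1))))
      fun v => Real.abs_cos_le_one _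
  have hci0 : Integrable (fun v : V3 => Real.cos (1 + 1 * v 0)) (stdGaussian V3) :=
    integrable_of_abs_le_stdGaussian (f := fun v : V3 => Real.cos (1 + 1 * v 0))
      (Real.continuous_cos.comp (continuous_const.add (continuous_const.mul (continuous_coord 0))))
      fun v => Real.abs_cos_le_one _
  rw [integral_const_mul, integral_sub hci1 hci0, integral_cos_coord, integral_cos_coord, PiLp.norm_single,
    Real.cos_zero] at hΓ
  simp only [Real.norm_eq_abs, abs_one, one_pow, mul_one] at hΓ
  norm_num at hΓ
  rw [show Real.exp (-(1 / 2) : ℝ) = c by rw [hc]; norm_num] at hΓ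
  have hcos := KineticFluxLdDecayTilt.one_sub_cos_one_ge
  nlinarith [mul_le_mul_of_nonneg_left hcos (by linarith : (0:ℝ) ≤ c)]

end TransferEntropyClockNegative

end Summit.AtomisticToContinuum.HydrodynamicLimit.Theorems

end
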